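import Summits.QuantumFields.BalabanUV.T4Continuum.Support.CovariantLineAveraging
import Summits.QuantumFields.BalabanUV.T4Continuum.Support.CompositeAveragingLaw
import Summits.QuantumFields.BalabanUV.T4Continuum.Spine.NE2ColourPerturbedLayer

/-!
# T⁴ programme, spine node NE2 (U1a) — BAŁABAN's LINE-AVERAGED COVARIANT VECTOR AVERAGING ALONG THE TOWER: the one-step covariant
# line-block averagings are an INSTANCE of `CompositeAveragingLaw.OneStepTransportLaws`, hence `AveragingLaws` for `Q_k(U) − Q_k` and the
# Gram row of `Δ_a(U)` for the `Q` that sits inside `Δ_a` (tier B, row B3.a-vec of `t4/formal/NE2/LEAVES.md`, file 3 of 3)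

NE2 formalisation swarm, seat `b2b-balaban-t4-ne2-formalise-leaf-02`.  Files 1–2 (`Support/CovariantLinePlanting`,
`Support/CovariantLineAveraging`) typed the ONE-STEP covariant line-block average `Qc T Rl` (at `T = Rl = 1` exactly Bałaban's `QB ⊗ 1`)
and proved `‖√(R^d)•(Qc T′ Rl′ − Qc T Rl)‖ ≤ ‖T′ − T‖∞ + ‖Rl′ − Rl‖∞` (contraction transporters).  The owner's `Support/CompositeAveragingLaw`
(p208238, row B3.e) proved the ABSTRACT composite-of-one-steps law ([Balaban1985BackgroundPropagators] (3.15) shape «Q_j(U) = Q(Ū^{(j−1)})⋯Q(U)»):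
`OneStepTransportLaws A At r ν θ cs → AveragingLaws D (Ecomp A At r) J (epsComp ν θ) (deltaComp γ′ ν θ f₀ cs)`.  This file is its CONCRETE
line-transport instance on the colour-lifted Bałaban tower (`freeTowerLaws_kron o freeTowerLaws_balaban`):
 * §1 DATA: for every total depth `k` and step `j`, block transporters `T k j : idx L M (j+1) → M_o(ℂ)` and line transporters `Rl k j t`
   (DEPTH-DEPENDENT: at depth `k` the step-`j` transporters come from the `j`-fold average of the level-`k` background — for Bałaban's
   `U_k(V)` these differ between depths `k` and `k + 1`); `QcT T Rl k j := Qc (L^j) L M (T k j) (Rl k j)`; the typed covariant averaging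
   **`QcovLine T Rl k := Btow (QcT T Rl k) (L^d) k`** (`= Btow (QBlev ⊗ₖ 1) (L^d) k` at `T = Rl = 1`, `QcovLine_one_one`), the reference
   `Bref k := Btow (QBlev ⊗ₖ 1) (L^d) k`, `Eline := Ecomp (QBlev ⊗ₖ 1) (QcT T Rl) (L^d) = QcovLine − Bref`; the hypothesis SHAPE
   **`LineTransportLaws T Rl αT αR βs`**: contractions; `‖T k j x − 1‖ ≤ αT·L^{−j}`, `‖Rl k j t x − 1‖ ≤ αR·L^{−j}` (one-step transporters are
   small AT THEIR OWN SCALE — path length ≤ dL bonds of size `L^{−j−1}`); TWO-DEPTH CONSISTENCY `‖T (k+1) j x − T k j x‖, ‖Rl (k+1) j t x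
   − Rl k j t x‖ ≤ βs k j` — node NE3's currency (the backgrounds `U_{k+1}(V)`, `U_k(V)` averaged `j` times differ by an η-rate), DISPLAYED,
   asserted by nobody (trigger c2);
 * §2 **`oneStepTransportLaws_line`**: `LineTransportLaws T Rl αT αR βs → OneStepTransportLaws (k ↦ QBlev k ⊗ₖ 1) (QcT T Rl) (L^d) (αT + αR) L⁻¹
   (k ↦ Σ_{j<k} 2·βs k j)`;
 * §3 the row's END **`averagingLaws_covariantLine`**: `AveragingLaws (k ↦ calDalev k ⊗ₖ 1) (Eline T Rl) (k ↦ JpcT k ⊗ₖ 1) (epsComp (αT + αR) L⁻¹)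
   (deltaComp Cst (αT + αR) L⁻¹ (k ↦ dL·Cst·L^{−k}) (k ↦ Σ_{j<k} 2βs k j))` BY NAME from `averagingLaws_composite`; the Gram row
   **`perturbationLaws_covariantLineGram`** (`gramCore Bref Eline k = (Q^U_k)ᴴQ^U_k − Q_kᴴQ_k`, the `B`-part being Bałaban's own composite
   averaging = `QvOp (L^k)` relabelled by `BalabanAveragedCoerciveTower.Atow_QBlev_eq_submatrix`); and, when the consistency budget is geometric
   (`Σ_{j<k} 2βs k j ≤ Ccs·L^{−k}`), the η-RATE **`towerLimitRate_covariantLineGram`** / **`covariantLineGram_rate`** (`t = 1`, `c = a`, threshold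
   DISPLAYED).
RELATION TO THE OTHER B3 ROWS (no identification asserted): rows B3.a/B3.a′/B3.b-conc/B3.b-inst (leaf-07/06/01) type ONE `k`-fold covariant
averaging with nested-contour transporters; this row's `Btow (QcT …)` is the composite-of-one-steps presentation; the two coincide only if the
transporter data are identified by (3.15), which no row asserts.  NOT modelled: the `O(L²α₀)` remainder (`g`-functions) of [Balaban1985Averaging] (124).

HONEST FRAMING (T4-DAG p. 1).  Model level (transporters as DATA, global small field); finite torus, linear layer, operator norm; rates /
pairings / constants OURS; NOT [B7] (124) or [B9] (3.26) as printed; ROOT B stays CONDITIONAL on NE3 (the `βs` budget) by name; NE2 NOT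
proved; NOT infinite volume / mass gap / Clay / summit progress; spine 0/9 unchanged.  HONEST DEPENDENCY: continuum YM on T⁴ ⇐ BetaPertH ∧
nine spine estimates (0/9 proved); BetaPertH ⇐ (D1) ∧ (D4) ∧ CAP+tail; G-an2-4 gates asym, D1 and NE2/3/4.  ABSOLUTE RULE kept; no `sorry`.
-/

noncomputable section

open scoped BigOperators ComplexConjugate Matrix Matrix.Norms.L2Operator Kronecker

namespace Summit.QuantumFields.BalabanUV.T4Continuum.CovariantLineAveragingTower

open Literature.MathematicalPhysics.QuantumFieldTheory.Balaban1983to89.B5Prop11Plancherel (fine Tor Cst Cst_nonneg)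
open Literature.MathematicalPhysics.QuantumFieldTheory.Balaban1983to89.B5G183RateUnitTower (lev lev_neZero)
open Summit.QuantumFields.BalabanUV.T4Continuum
open Summit.QuantumFields.BalabanUV.T4Continuum.CovariantAveragingTower (Atow TowerLimitRate)
open Summit.QuantumFields.BalabanUV.T4Continuum.BalabanAveragedTowerUnit (idx Qlev QBlev one_le_lev' cast_lev' opNorm_QBlev_sq_le)
open Summit.QuantumFields.BalabanUV.T4Continuum.BackgroundResolventTower
open Summit.QuantumFields.BalabanUV.T4Continuum.KingPairingPlantedLaw
open Summit.QuantumFields.BalabanUV.T4Continuum.NE2ColourPerturbedLayer (pow_d_pos opNorm_inv_calDalev_kron_le towerLimitRate_perturbed_king_kron)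
open Summit.QuantumFields.BalabanUV.T4Continuum.BalabanAveragingPairing (freeTowerLaws_balaban)
open Summit.QuantumFields.BalabanUV.T4Continuum.KroneckerLift
open Summit.QuantumFields.BalabanUV.T4Continuum.PerturbationAlgebra (perturbationLaws_mono perturbationLaws_smul)
open Summit.QuantumFields.BalabanUV.T4Continuum.GramPerturbationLaw
open Summit.QuantumFields.BalabanUV.T4Continuum.CompositeAveragingLaw
open Summit.QuantumFields.BalabanUV.T4Continuum.CovariantLineAveraging

variable {d : ℕ} (L : ℕ) [NeZero L] (M : Fin d → ℕ) [hM : ∀ μ, NeZero (M μ)]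
variable {o : Type*} [Fintype o] [DecidableEq o]

/-! ## §1 The objects along the tower and the hypothesis shape -/

/-- the one-step covariant line-block average at step `j` of the depth-`k` family (lattice `L^{−j−1} → L^{−j}`), data `T k j`, `Rl k j`.
[folklore] -/
def QcT (T : ℕ → (j : ℕ) → idx L M (j + 1) → Matrix o o ℂ) (Rl : ℕ → (j : ℕ) → Fin L → idx L M (j + 1) → Matrix o o ℂ) (k j : ℕ) :
    Matrix (idx L M j × o) (idx L M (j + 1) × o) ℂ :=
  Qc (lev L j) L M (T k j) (Rl k j)

/-- **THE TYPED COVARIANT `k`-FOLD AVERAGING** `Q^U_k = √((L^d)^k)•QcT k 0 ⋯ QcT k (k−1)` (normalised composite of the depth-`k` family).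
[cite: Balaban1985BackgroundPropagators, (3.15) p.393 (shape: composition of one-step averagings)] [folklore] -/
def QcovLine (T : ℕ → (j : ℕ) → idx L M (j + 1) → Matrix o o ℂ) (Rl : ℕ → (j : ℕ) → Fin L → idx L M (j + 1) → Matrix o o ℂ) (k : ℕ) :
    Matrix (idx L M 0 × o) (idx L M k × o) ℂ :=
  Btow (QcT L M T Rl k) ((L : ℝ) ^ d) k

/-- the reference: Bałaban's own composite (1.18) averaging, lifted to colours and normalised (`= QvOp (L^k)` relabelled, by
`BalabanAveragedCoerciveTower.Atow_QBlev_eq_submatrix`). [folklore] -/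
def Bref (k : ℕ) : Matrix (idx L M 0 × o) (idx L M k × o) ℂ :=
  Btow (fun k => QBlev L M k ⊗ₖ (1 : Matrix o o ℂ)) ((L : ℝ) ^ d) k

/-- the transport error `E_k = Q^U_k − Q_k` (an instance of `CompositeAveragingLaw.Ecomp`). [folklore] -/
def Eline (T : ℕ → (j : ℕ) → idx L M (j + 1) → Matrix o o ℂ) (Rl : ℕ → (j : ℕ) → Fin L → idx L M (j + 1) → Matrix o o ℂ) (k : ℕ) :
    Matrix (idx L M 0 × o) (idx L M k × o) ℂ :=
  Ecomp (fun k => QBlev L M k ⊗ₖ (1 : Matrix o o ℂ)) (QcT L M T Rl) ((L : ℝ) ^ d) k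

/-- `Eline = QcovLine − Bref` (definitional). [folklore] -/
theorem Eline_eq (T : ℕ → (j : ℕ) → idx L M (j + 1) → Matrix o o ℂ) (Rl : ℕ → (j : ℕ) → Fin L → idx L M (j + 1) → Matrix o o ℂ)
    (k : ℕ) : Eline L M T Rl k = QcovLine L M T Rl k - Bref L M k := rfl

/-- at `T = Rl = 1` the one-step covariant average is `QBlev ⊗ 1`. [folklore] -/
theorem QcT_one_one (k j : ℕ) :
    QcT L M (fun _ _ _ => (1 : Matrix o o ℂ)) (fun _ _ _ _ => (1 : Matrix o o ℂ)) k j = QBlev L M j ⊗ₖ (1 : Matrix o o ℂ) :=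
  Qc_one_one (lev L j) L M

/-- **at `T = Rl = 1` the typed covariant averaging IS `Btow (QBlev ⊗ₖ 1) (L^d) k`** (the row's normalisation clause). [folklore] -/
theorem QcovLine_one_one (k : ℕ) :
    QcovLine L M (fun _ _ _ => (1 : Matrix o o ℂ)) (fun _ _ _ _ => (1 : Matrix o o ℂ)) k = Bref L M k := by
  have h : QcT L M (fun _ _ _ => (1 : Matrix o o ℂ)) (fun _ _ _ _ => (1 : Matrix o o ℂ)) k
      = fun j => QBlev L M j ⊗ₖ (1 : Matrix o o ℂ) := funext fun j => QcT_one_one L M k j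
  rw [QcovLine, h, Bref]

/-- **THE LAWS OF THE ONE-STEP TRANSPORT DATA** (hypothesis SHAPE on data, asserted by nobody): contractions; smallness of the one-step
block / line transporters at their own scale; TWO-DEPTH CONSISTENCY with budget `βs k j` (node NE3's currency). [folklore] -/
structure LineTransportLaws (T : ℕ → (j : ℕ) → idx L M (j + 1) → Matrix o o ℂ)
    (Rl : ℕ → (j : ℕ) → Fin L → idx L M (j + 1) → Matrix o o ℂ) (αT αR : ℝ) (βs : ℕ → ℕ → ℝ) : Prop where
  /-- `αT, αR ≥ 0`, `βs ≥ 0` -/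
  nonneg : 0 ≤ αT ∧ 0 ≤ αR ∧ ∀ k j, 0 ≤ βs k j
  /-- block transporters are contractions -/
  norm_T_le : ∀ k j x, ‖T k j x‖ ≤ 1
  /-- line transporters are contractions -/
  norm_R_le : ∀ k j t x, ‖Rl k j t x‖ ≤ 1
  /-- one-step block transporters are close to `1` at their scale -/
  T_sub_one_le : ∀ k j x, ‖T k j x - 1‖ ≤ αT * ((L : ℝ)⁻¹) ^ j
  /-- line transporters are close to `1` at their scale -/
  R_sub_one_le : ∀ k j t x, ‖Rl k j t x - 1‖ ≤ αR * ((L : ℝ)⁻¹) ^ j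
  /-- two-depth consistency of the block transporters (NE3 currency) -/
  T_consistent : ∀ k j x, ‖T (k + 1) j x - T k j x‖ ≤ βs k j
  /-- two-depth consistency of the line transporters (NE3 currency) -/
  R_consistent : ∀ k j t x, ‖Rl (k + 1) j t x - Rl k j t x‖ ≤ βs k j

/-! ## §2 The instance of `OneStepTransportLaws` -/

section Instance

variable {T : ℕ → (j : ℕ) → idx L M (j + 1) → Matrix o o ℂ} {Rl : ℕ → (j : ℕ) → Fin L → idx L M (j + 1) → Matrix o o ℂ}
  {αT αR : ℝ} {βs : ℕ → ℕ → ℝ}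

/-- **ONE STEP, SIZE: `‖√(L^d)•(QcT k j − QBlev j ⊗ 1)‖ ≤ (αT + αR)·L^{−j}`**. [folklore] -/
theorem opNorm_sqrt_smul_QcT_sub_le (h : LineTransportLaws L M T Rl αT αR βs) (k j : ℕ) :
    ‖(((Real.sqrt ((L : ℝ) ^ d) : ℝ) : ℂ)) • (QcT L M T Rl k j - QBlev L M j ⊗ₖ (1 : Matrix o o ℂ))‖ ≤ (αT + αR) * ((L : ℝ)⁻¹) ^ j := by
  have hρ : 0 ≤ ((L : ℝ)⁻¹) ^ j := pow_nonneg (inv_nonneg.mpr (Nat.cast_nonneg L)) j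
  refine (opNorm_sqrt_smul_Qc_sub_le (lev L j) L M (mul_nonneg h.nonneg.1 hρ) (mul_nonneg h.nonneg.2.1 hρ) (h.T_sub_one_le k j)
    (h.norm_R_le k j) (h.R_sub_one_le k j)).trans (le_of_eq ?_)
  ring

/-- **ONE STEP, TWO DEPTHS: `‖√(L^d)•(QcT (k+1) j − QcT k j)‖ ≤ 2·βs k j`**. [folklore] -/
theorem opNorm_sqrt_smul_QcT_sub_QcT_le (h : LineTransportLaws L M T Rl αT αR βs) (k j : ℕ) :
    ‖(((Real.sqrt ((L : ℝ) ^ d) : ℝ) : ℂ)) • (QcT L M T Rl (k + 1) j - QcT L M T Rl k j)‖ ≤ 2 * βs k j := by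
  refine (opNorm_sqrt_smul_Qc_sub_Qc_le (lev L j) L M (h.nonneg.2.2 k j) (h.nonneg.2.2 k j) (h.T_consistent k j) (h.norm_T_le k j)
    (h.norm_R_le (k + 1) j) (h.R_consistent k j)).trans (le_of_eq ?_)
  ring

/-- **THE ONE-STEP COVARIANT LINE-BLOCK AVERAGINGS SATISFY `OneStepTransportLaws`** over the colour-lifted Bałaban tower, with `ν = αT + αR`,
`θ = L⁻¹`, consistency budget `cs k = Σ_{j<k} 2βs k j` (`L ≥ 2`). [folklore] -/
theorem oneStepTransportLaws_line (hL : 2 ≤ L) (h : LineTransportLaws L M T Rl αT αR βs) :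
    OneStepTransportLaws (fun j => QBlev L M j ⊗ₖ (1 : Matrix o o ℂ)) (QcT L M T Rl) ((L : ℝ) ^ d) (αT + αR) ((L : ℝ)⁻¹)
      (fun k => ∑ j ∈ Finset.range k, 2 * βs k j) where
  nonneg := by
    have hL1 : (1 : ℝ) < L := by exact_mod_cast (lt_of_lt_of_le one_lt_two hL : 1 < L)
    exact ⟨add_nonneg h.nonneg.1 h.nonneg.2.1, inv_nonneg.mpr (zero_le_one.trans hL1.le), inv_lt_one_of_one_lt₀ hL1⟩
  size := fun k j => opNorm_sqrt_smul_QcT_sub_le L M h k j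
  consistent := fun k => Finset.sum_le_sum fun j _ => opNorm_sqrt_smul_QcT_sub_QcT_le L M h k j

end Instance

/-! ## §3 `AveragingLaws` for the transport error, the Gram row, the η-rate -/

section Laws

variable (a : ℝ) (ha : 0 < a)
variable {T : ℕ → (j : ℕ) → idx L M (j + 1) → Matrix o o ℂ} {Rl : ℕ → (j : ℕ) → Fin L → idx L M (j + 1) → Matrix o o ℂ}
  {αT αR : ℝ} {βs : ℕ → ℕ → ℝ}

/-- **`AveragingLaws` FOR THE TRANSPORT ERROR OF BAŁABAN's LINE-AVERAGED COVARIANT AVERAGING** (the row's END; `L ≥ 2`): size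
`epsComp (αT + αR) L⁻¹`, sandwiched pairings `deltaComp Cst (αT + αR) L⁻¹ (k ↦ dL·Cst·L^{−k}) (k ↦ Σ_{j<k} 2βs k j)` — BY NAME from the owner's
`averagingLaws_composite` on the colour-lifted Bałaban tower. [cite: Balaban1984PropagatorsI, (1.18) p.20, Prop. 1.1 (1.89) p.33;
Balaban1985Averaging, (125) p.36 (shape)] [folklore] -/
theorem averagingLaws_covariantLine (hL : 2 ≤ L) (h : LineTransportLaws L M T Rl αT αR βs) :
    AveragingLaws (fun k => calDalev L M a ha k ⊗ₖ (1 : Matrix o o ℂ)) (Eline L M T Rl) (fun k => JpcT L M k ⊗ₖ (1 : Matrix o o ℂ))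
      (epsComp (αT + αR) ((L : ℝ)⁻¹))
      (deltaComp (Cst d a) (αT + αR) ((L : ℝ)⁻¹) (fun k => d * L * Cst d a * ((L : ℝ)⁻¹) ^ k) (fun k => ∑ j ∈ Finset.range k, 2 * βs k j)) :=
  averagingLaws_composite (pow_d_pos (d := d) L) (freeTowerLaws_kron o (freeTowerLaws_balaban L M a ha)) (opNorm_inv_calDalev_kron_le L M a ha)
    (oneStepTransportLaws_line L M hL h)

/-- **`AveragingLaws` FOR THE REFERENCE** (Bałaban's composite (1.18) averaging, colour-lifted): size `1`, sandwiched pairings the free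
pairing defect `dL·Cst·L^{−k}` of `freeTowerLaws_balaban`. [cite: Balaban1984PropagatorsI, (1.18) p.20, Prop. 1.1 (1.89) p.33] [folklore] -/
theorem averagingLaws_reference :
    AveragingLaws (fun k => calDalev L M a ha k ⊗ₖ (1 : Matrix o o ℂ)) (Bref L M) (fun k => JpcT L M k ⊗ₖ (1 : Matrix o o ℂ)) 1
      (fun k => d * L * Cst d a * ((L : ℝ)⁻¹) ^ k) :=
  averagingLaws_Btow (pow_d_pos (d := d) L) (freeTowerLaws_kron o (freeTowerLaws_balaban L M a ha))

/-- `Q_k + E_k = Q^U_k`: the Gram perturbation `gramCore Bref Eline` IS `(Q^U)ᴴQ^U − QᴴQ` (normalised). [folklore] -/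
theorem gramCore_eq (k : ℕ) :
    gramCore (Bref L M) (Eline L M T Rl) k = (QcovLine L M T Rl k)ᴴ * QcovLine L M T Rl k - (Bref L M k)ᴴ * Bref L M k :=
  gramCore_composite_eq _ _ _ k

/-- the Neumann constant of the row `κ_Q(c) = ‖c‖·ε(2 + ε)·Cst`, `ε = epsComp (αT + αR) L⁻¹`. [folklore] -/
def kappaLine (d L : ℕ) (a αT αR : ℝ) (c : ℂ) : ℝ :=
  ‖c‖ * (epsComp (αT + αR) ((L : ℝ)⁻¹) * (2 * 1 + epsComp (αT + αR) ((L : ℝ)⁻¹)) * Cst d a)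

/-- **THE GRAM ROW OF `Δ_a(U)` FOR THE `Q` INSIDE `Δ_a`** (`L ≥ 2`): `PerturbationLaws (Δ_a ⊗ 1) (c·((Q^U)ᴴQ^U − QᴴQ)) (J ⊗ 1) κ_Q e₂` with
`e₂ = ‖c‖·e2gram Cst 1 ε (2dCst·L^{−k}) (CJ·L^{−k}) (dLCst·L^{−k}) (deltaComp …)` — a THEOREM of the model; CONDITIONAL content = the `βs` budget
(NE3) only. [cite: Balaban1985BackgroundPropagators, (3.26) p.395 (where `Q*(U)aQ(U)` enters); Balaban1984PropagatorsI, (1.69) p.29,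
Prop. 1.1 (1.89) p.33] [folklore] -/
theorem perturbationLaws_covariantLineGram (hL : 2 ≤ L) (h : LineTransportLaws L M T Rl αT αR βs) (c : ℂ) :
    PerturbationLaws (fun k => calDalev L M a ha k ⊗ₖ (1 : Matrix o o ℂ)) (gramPert c (Bref L M) (Eline L M T Rl))
      (fun k => JpcT L M k ⊗ₖ (1 : Matrix o o ℂ)) (kappaLine d L a αT αR c)
      (fun k => ‖c‖ * e2gram (Cst d a) 1 (epsComp (αT + αR) ((L : ℝ)⁻¹)) (fun k => 2 * d * Cst d a * ((L : ℝ)⁻¹) ^ k)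
        (fun k => CJ d a * ((L : ℝ)⁻¹) ^ k) (fun k => d * L * Cst d a * ((L : ℝ)⁻¹) ^ k)
        (deltaComp (Cst d a) (αT + αR) ((L : ℝ)⁻¹) (fun k => d * L * Cst d a * ((L : ℝ)⁻¹) ^ k)
          (fun k => ∑ j ∈ Finset.range k, 2 * βs k j)) k) :=
  perturbationLaws_gramPert (freeTowerLaws_kron o (freeTowerLaws_balaban L M a ha)) (opNorm_inv_calDalev_kron_le L M a ha)
    (averagingLaws_reference L M a ha) (averagingLaws_covariantLine L M a ha hL h) c

/-- the geometric consistency constant when the two-depth budget is geometric: `C₂^Q(c) = ‖c‖·C2gram Cst 1 ε (2dCst) CJ (dLCst) Cδ`,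
`Cδ = (Cst + dLCst)·bexp·Ccs + ε·dLCst + bexp·Cst·(αT + αR)`. [folklore] -/
def C2line (d L : ℕ) (a αT αR Ccs : ℝ) (c : ℂ) : ℝ :=
  ‖c‖ * C2gram (Cst d a) 1 (epsComp (αT + αR) ((L : ℝ)⁻¹)) (2 * d * Cst d a) (CJ d a) (d * L * Cst d a)
    ((Cst d a + d * L * Cst d a) * (bexp (αT + αR) ((L : ℝ)⁻¹) * Ccs)
      + epsComp (αT + αR) ((L : ℝ)⁻¹) * (d * L * Cst d a) + bexp (αT + αR) ((L : ℝ)⁻¹) * Cst d a * (αT + αR))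

omit [NeZero L] hM in
/-- `deltaComp` is geometric when the consistency budget is. [folklore] -/
theorem deltaComp_le_geom (hL : 2 ≤ L) (hα : 0 ≤ αT + αR) (hβs : ∀ k j, 0 ≤ βs k j) {Ccs : ℝ}
    (hcs : ∀ k, ∑ j ∈ Finset.range k, 2 * βs k j ≤ Ccs * ((L : ℝ)⁻¹) ^ k) (k : ℕ) :
    deltaComp (Cst d a) (αT + αR) ((L : ℝ)⁻¹) (fun k => d * L * Cst d a * ((L : ℝ)⁻¹) ^ k) (fun k => ∑ j ∈ Finset.range k, 2 * βs k j) k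
      ≤ ((Cst d a + d * L * Cst d a) * (bexp (αT + αR) ((L : ℝ)⁻¹) * Ccs)
          + epsComp (αT + αR) ((L : ℝ)⁻¹) * (d * L * Cst d a) + bexp (αT + αR) ((L : ℝ)⁻¹) * Cst d a * (αT + αR)) * ((L : ℝ)⁻¹) ^ k := by
  have hL1 : (1 : ℝ) ≤ L := by exact_mod_cast (le_trans one_le_two hL : 1 ≤ L)
  have hρ0 : (0 : ℝ) ≤ (L : ℝ)⁻¹ := inv_nonneg.mpr (zero_le_one.trans hL1)
  have hρk : 0 ≤ ((L : ℝ)⁻¹) ^ k := pow_nonneg hρ0 k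
  have hρk1 : ((L : ℝ)⁻¹) ^ k ≤ 1 := pow_le_one₀ hρ0 (inv_le_one_of_one_le₀ hL1)
  have hC := Cst_nonneg d a
  have hb := (bexp_pos (αT + αR) ((L : ℝ)⁻¹)).le
  have hf : 0 ≤ d * L * Cst d a := by positivity
  have hε : 0 ≤ epsComp (αT + αR) ((L : ℝ)⁻¹) := by
    unfold epsComp
    exact mul_nonneg hb (mul_nonneg hα (inv_nonneg.mpr (sub_nonneg.mpr (inv_le_one_of_one_le₀ hL1))))
  unfold deltaComp
  have h1 : (Cst d a + d * L * Cst d a * ((L : ℝ)⁻¹) ^ k) * (bexp (αT + αR) ((L : ℝ)⁻¹) * ∑ j ∈ Finset.range k, 2 * βs k j)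
      ≤ (Cst d a + d * L * Cst d a) * (bexp (αT + αR) ((L : ℝ)⁻¹) * Ccs) * ((L : ℝ)⁻¹) ^ k := by
    have hs : 0 ≤ ∑ j ∈ Finset.range k, 2 * βs k j :=
      Finset.sum_nonneg fun j _ => mul_nonneg zero_le_two (hβs k j)
    have a1 : Cst d a + d * L * Cst d a * ((L : ℝ)⁻¹) ^ k ≤ Cst d a + d * L * Cst d a := by nlinarith
    calc _ ≤ (Cst d a + d * L * Cst d a) * (bexp (αT + αR) ((L : ℝ)⁻¹) * ∑ j ∈ Finset.range k, 2 * βs k j) :=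
          mul_le_mul_of_nonneg_right a1 (mul_nonneg hb hs)
      _ ≤ (Cst d a + d * L * Cst d a) * (bexp (αT + αR) ((L : ℝ)⁻¹) * (Ccs * ((L : ℝ)⁻¹) ^ k)) :=
          mul_le_mul_of_nonneg_left (mul_le_mul_of_nonneg_left (hcs k) hb) (by positivity)
      _ = _ := by ring
  have h2 : epsComp (αT + αR) ((L : ℝ)⁻¹) * (d * L * Cst d a * ((L : ℝ)⁻¹) ^ k)
      = epsComp (αT + αR) ((L : ℝ)⁻¹) * (d * L * Cst d a) * ((L : ℝ)⁻¹) ^ k := by ring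
  have h3 : bexp (αT + αR) ((L : ℝ)⁻¹) * Cst d a * ((αT + αR) * ((L : ℝ)⁻¹) ^ k)
      = bexp (αT + αR) ((L : ℝ)⁻¹) * Cst d a * (αT + αR) * ((L : ℝ)⁻¹) ^ k := by ring
  rw [h2, h3]
  nlinarith [h1]

/-- **η-RATE FOR THE COVARIANT-AVERAGING GRAM COUPLING** (`L ≥ 2`, geometric consistency budget `Σ_{j<k} 2βs k j ≤ Ccs·L^{−k}`, `‖t‖κ_Q < 1`):
the King-averaged unit-lattice covariances of `(Δ_a^{(k)} ⊗ 1 + t·c·((Q^U_k)ᴴQ^U_k − Q_kᴴQ_k))⁻¹` converge with rate `L^{−k}`.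
[cite: King1986, Lemma 4.5 (4.32)/(4.38) p.674 (scalar template); Balaban1985BackgroundPropagators, (3.26) p.395] [folklore] -/
theorem towerLimitRate_covariantLineGram (hL : 2 ≤ L) (h : LineTransportLaws L M T Rl αT αR βs) {Ccs : ℝ}
    (hcs : ∀ k, ∑ j ∈ Finset.range k, 2 * βs k j ≤ Ccs * ((L : ℝ)⁻¹) ^ k) (c : ℂ) {t : ℂ} (ht : ‖t‖ * kappaLine d L a αT αR c < 1) :
    TowerLimitRate (fun k => Qlev L M k ⊗ₖ (1 : Matrix o o ℂ)) ((L : ℝ) ^ d)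
      (fun k => (calDalev L M a ha k ⊗ₖ (1 : Matrix o o ℂ) + t • gramPert c (Bref L M) (Eline L M T Rl) k)⁻¹)
      (Cpert (kappaLine d L a αT αR c) (2 * d * Cst d a) (CJ d a) (C2line d L a αT αR Ccs c) 0 t) ((L : ℝ)⁻¹) := by
  have hL1 : (1 : ℝ) < L := by exact_mod_cast (lt_of_lt_of_le one_lt_two hL : 1 < L)
  have hα : 0 ≤ αT + αR := add_nonneg h.nonneg.1 h.nonneg.2.1
  have hε : 0 ≤ epsComp (αT + αR) ((L : ℝ)⁻¹) := by
    unfold epsComp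
    exact mul_nonneg (bexp_pos _ _).le (mul_nonneg hα (inv_nonneg.mpr (sub_nonneg.mpr (inv_lt_one_of_one_lt₀ hL1).le)))
  have hpert : PerturbationLaws (fun k => calDalev L M a ha k ⊗ₖ (1 : Matrix o o ℂ)) (gramPert c (Bref L M) (Eline L M T Rl))
      (fun k => JpcT L M k ⊗ₖ (1 : Matrix o o ℂ)) (kappaLine d L a αT αR c) (fun k => C2line d L a αT αR Ccs c * ((L : ℝ)⁻¹) ^ k) := by
    refine perturbationLaws_mono (perturbationLaws_covariantLineGram L M a ha hL h c) le_rfl fun k => ?_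
    refine (mul_le_mul_of_nonneg_left (e2gram_le_geom (ρ := (L : ℝ)⁻¹) (Cst_nonneg d a) zero_le_one hε (fun k => le_rfl)
      (fun k => le_rfl) (fun k => le_rfl) (deltaComp_le_geom L a hL hα h.nonneg.2.2 hcs) k) (norm_nonneg c)).trans (le_of_eq ?_)
    unfold C2line; ring
  exact towerLimitRate_perturbed_king_kron L M a ha hL hpert ht

/-- **THE PHYSICAL VALUE** `t = 1`, `c = a` (the `a` of `Q*aQ`), in the small-field regime `κ_Q(a) < 1` DISPLAYED. [folklore] -/
theorem covariantLineGram_rate (hL : 2 ≤ L) (h : LineTransportLaws L M T Rl αT αR βs) {Ccs : ℝ}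
    (hcs : ∀ k, ∑ j ∈ Finset.range k, 2 * βs k j ≤ Ccs * ((L : ℝ)⁻¹) ^ k) (hsmall : kappaLine d L a αT αR (a : ℂ) < 1) :
    TowerLimitRate (fun k => Qlev L M k ⊗ₖ (1 : Matrix o o ℂ)) ((L : ℝ) ^ d)
      (fun k => (calDalev L M a ha k ⊗ₖ (1 : Matrix o o ℂ) + gramPert (a : ℂ) (Bref L M) (Eline L M T Rl) k)⁻¹)
      (Cpert (kappaLine d L a αT αR (a : ℂ)) (2 * d * Cst d a) (CJ d a) (C2line d L a αT αR Ccs (a : ℂ)) 0 1) ((L : ℝ)⁻¹) := by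
  have h1 := towerLimitRate_covariantLineGram L M a ha hL h hcs (a : ℂ) (t := 1) (by rwa [norm_one, one_mul])
  simpa only [one_smul] using h1

end Laws

end Summit.QuantumFields.BalabanUV.T4Continuum.CovariantLineAveragingTower

end
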